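import Summits.CriticalPhenomena.PercolationContinuityZ3.Theorems.PercNearOneGluingNoHeavyQuantGatedSliceMixLawRegimeBTools
import HarnessLib

/-!
# QUANT lane R8, T-DEC, leg (III), blob case — `LawDec.GatedSliceMixLaw'` in REGIME B, cell B-TWIN (the twin `ℓ = k₁ + a` of the low
# `k₁` is a MID, the top `k₂` a GIANT): the EXCHANGE CERTIFICATE — `k₁` fills its twin, the overflow rides `W_h`'s mid `h` and / or the
# giants, the zeros ride the giants — reduces the cell to ONE pooled inequality

builds on p205010 (kernel theorem, internal audit signed; external expert review pending)

Support file (`--supports stmt-CriticalPhenomena-4575`), QUANT lane seat prim-quant-arm-2 (gen 36), rung R8 of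
`run/shared/lean/prim/quant/LADDER.md`; lead g32's recipe (lane INBOX l.1077/l.1080, memo
`run/shared/lean/prim/quant/prim-quant-lead-g32/FOR-PROVERS-MIXLAW-KINKS.md` §8) and census-2 g61's certificate of record for
`LawDec.MixLawCellBTwin` (`…QuantGatedSliceMixLawRegimeBCells`).  Theorems only, standard axioms, no sorries, no definitions.
Template: lead g32's `…QuantGatedSliceMixLawRegimeBKink2` (pair flows + criterion E + normalisation).

THE CELL.  Frame of `GatedSliceMixLaw'` (`t = S + ag(1−z)`, `u = y/(1−y)`, `P = z·δ₀ + m₁δ_{k₁} + m₁'δ_ℓ + m₂δ_{k₂} + m₂'δ_{k₂+a}`,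
`m₁ = (1−z)(1−λ)(1−g)`, `m₁' = (1−z)(1−λ)g`, `m₂ + m₂' = (1−z)λ`; `W_h = w₀δ₀ + w_hδ_h + W_Gδ_{h+a}`, `w₀ = 1 − S/h`, `w_h = (S/h)(1−g)`,
`W_G = (S/h)g`); regime B (`h + a ≥ j+1`, `h` a mid); `k₁` a `t`-low, its twin `ℓ = k₁ + a ≤ j` NOT a `t`-low (`t ≤ 2ℓ`), `k₂ ≥ j+1`.
So the lows of `Q_θ = θ·W_h + (1−θ)·P` are the zeros and `k₁`; the mids are `ℓ` (P's) and `h` (W's); everything else is a giant.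

THE CERTIFICATE (`gatedSliceMixLaw_BTwin_exchange`).  Split `m₁ = x_P + x_H + x_G` (`x ≥ 0`): `x_P` into the twin (within capacity
`usage(k₁,ℓ)·x_P ≤ m₁'`, only if `t < k₁ + ℓ`), `x_H` into `W_h`'s mid (only if `t < k₁ + h`), `x_G` to the giants; take the unnormalised
mixture `D·W_h + w_h·P` with `D := usage(k₁,h)·x_H` (the mid `h` EXACTLY full) and ship every zero to the giants.  Criterion E for the
zeros reads `D(u w₀ − W_G) ≤ w_h((1−z)λ − u z − u x_G)`, and since `W_h` sells mid mass at a giant price `u w₀ − W_G ≤ w_h` per unit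
(top-affordability `y·h ≤ S`), it follows from the POOLED INEQUALITY  **`usage(k₁,h)·x_H + u·x_G + u·z ≤ (1−z)λ`**  — the one hypothesis
of the theorem (no `W_h ∉ D`, no mean identity needed).  With `x_H = 0` this is the `θ = 0` routing; with `x_G = 0` the single-donor kink.
EVIDENCE for the pooled inequality on the cell (seat census, `run/shared/lean/prim/quant/prim-quant-arm-2-g36/code/` eng2.py / census2–5,
exact greedy + vertex LP, floats): with the greedy split (twin first, overflow to the cheaper of `h` / giants) it holds in 60 000 / 60 000
cell instances (W DEC or not; minimal relative slack ≈ 5 % away from degenerate corners); the `θ = 0` part alone fails in 12 / 60 000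
(there `k₁` is light at `h`).  Census-2 g61: 2 500 LP / 0, certificate 1 561 / 1 561.

* **`LawDec.gatedSliceMixLaw_BTwin_exchange`** — cell B-TWIN frame ∧ split ∧ pooled inequality ⟹ the conclusion of `GatedSliceMixLaw'`.
* `LawDec.gatedSliceMixLaw_BTwin_fit` — the twin holds ALL of `k₁` (`usage(k₁,ℓ)·m₁ ≤ m₁'`, e.g. the pair `(k₁,ℓ)` light or its gate
  `≤ g`): the conclusion with `θ = 0`, the zeros by `mixLawB_QG` (`u z ≤ (1−z)λ` on the cell).
HONEST STATUS: `MixLawCellBTwin` = this certificate + the pooled inequality on the residue `usage(k₁,ℓ)·m₁ > m₁'` (OPEN as a real-algebra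
lemma; evidence above); `MixLawRegimeB`, `GatedSliceMixLaw'`, CW, `SingleGateConvClosed`, `TreeDEC`, `FarTreeRow` OPEN; RATE class log* /
honest sentence unchanged.

[this work]; exchange architecture: prim-quant-stmt g30; flow form / criterion E: prim-quant-stmt g22–g26; cell map: lead g32, census-2
g61 (this lane).  Nothing here is cited as a published result.  The gluing rows served [cite: KozmaNitzan2024, Conjecture 3 (p. 15)]; product
measure [cite: Grimmett1999, §1.3 p. 10].
-/

noncomputable section

namespace Summit.CriticalPhenomena.PercolationContinuityZ3.Theorems

namespace Quant

open Finset

/-- the two-point law `{lo, hi; g}` (as in `…QuantLawDEC`) -/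
local notation3 "TP[" lo ", " hi ", " g ", " h "]" =>
  (g : ℝ) * (if (h : ℕ) = (hi : ℕ) then (1 : ℝ) else 0) + (1 - (g : ℝ)) * (if (h : ℕ) = (lo : ℕ) then (1 : ℝ) else 0)

namespace LawDec

/-! ### Cell B-TWIN: the exchange certificate -/

set_option maxHeartbeats 800000 in
/-- **`GatedSliceMixLaw'` ON CELL B-TWIN FROM THE POOLED INEQUALITY.**  Regime B (`h + a ≥ j+1`, `t ≤ 2h`), `k₁` a `t`-low, its twin
`ℓ = k₁ + a ≤ j` a mid (`t ≤ 2ℓ`), `k₂ ≥ j+1`, `g < 1`; a split `x_P + x_H + x_G = m₁` of the low `k₁` (twin / `W_h`'s mid / giants, each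
mid used only when compatible, the twin within capacity) with `usage(k₁,h)·x_H + u·x_G + u·z ≤ (1−z)λ`: then `θ·W_h + (1−θ)·P` is DEC at
`θ = D/(w_h + D)`, `D = usage(k₁,h)·x_H`. [this work] -/
theorem gatedSliceMixLaw_BTwin_exchange (y z g S lam : ℝ) (a j M h k₁ k₂ : ℕ) (xP xH xG : ℝ)
    (hy0 : 0 < y) (hy1 : y < 1) (hz0 : 0 ≤ z) (hz1 : z < 1) (hg0 : 0 ≤ g) (hg1 : g < 1)
    (hS0 : 0 < S) (hta : y * (M : ℝ) ≤ S) (hhj : h ≤ j) (hhM : h ≤ M) (hSh : S < (h : ℝ))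
    (hk : k₁ ≤ k₂) (hk₂M : k₂ ≤ M) (hlam0 : 0 ≤ lam) (hlam1 : lam ≤ 1)
    (hk₁j : k₁ ≤ j) (hk₁low : 2 * (k₁ : ℝ) < S + (a : ℝ) * g * (1 - z))
    (hPj : k₁ + a ≤ j) (hPmid : S + (a : ℝ) * g * (1 - z) ≤ 2 * ((k₁ + a : ℕ) : ℝ))
    (hk₂G : j + 1 ≤ k₂) (hhaG : j + 1 ≤ h + a) (hhmid : S + (a : ℝ) * g * (1 - z) ≤ 2 * (h : ℝ))
    (hxP0 : 0 ≤ xP) (hxH0 : 0 ≤ xH) (hxG0 : 0 ≤ xG) (hsplit : xP + xH + xG = (1 - z) * (1 - lam) * (1 - g))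
    (hPcomp : 0 < xP → S + (a : ℝ) * g * (1 - z) < (k₁ : ℝ) + ((k₁ + a : ℕ) : ℝ))
    (hHcomp : 0 < xH → S + (a : ℝ) * g * (1 - z) < (k₁ : ℝ) + (h : ℝ))
    (hcapP : usage y (S + (a : ℝ) * g * (1 - z)) j k₁ (k₁ + a) * xP ≤ (1 - z) * (1 - lam) * g)
    (hpool : usage y (S + (a : ℝ) * g * (1 - z)) j k₁ h * xH + y / (1 - y) * xG + y / (1 - y) * z ≤ (1 - z) * lam) :
    ∃ θ : ℝ, 0 ≤ θ ∧ θ < 1 ∧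
      DECAtT y (S + (a : ℝ) * g * (1 - z)) j (M + a)
        (fun p => θ * weakMidLaw S g h a p
          + (1 - θ) * (z * (if p = 0 then (1 : ℝ) else 0) + (1 - z) * slice (fun q => TP[k₁, k₂, lam, q]) a g p)) := by
  classical
  set t : ℝ := S + (a : ℝ) * g * (1 - z) with ht
  -- positivity
  have h1z : 0 < 1 - z := by linarith
  have h1y : 0 < 1 - y := by linarith
  have h1g : 0 < 1 - g := by linarith
  have hh0 : (0 : ℝ) < h := lt_trans hS0 hSh
  have hu0 : 0 < y / (1 - y) := div_pos hy0 h1y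
  have h1lam : 0 ≤ 1 - lam := by linarith
  have hyh : y * (h : ℝ) ≤ S := le_trans (mul_le_mul_of_nonneg_left (by exact_mod_cast hhM) hy0.le) hta
  -- masses
  set m₁' : ℝ := (1 - z) * (1 - lam) * g with hm₁'
  have hm₁'0 : 0 ≤ m₁' := mul_nonneg (mul_nonneg h1z.le h1lam) hg0
  have hwh : 0 < S / h * (1 - g) := mul_pos (div_pos hS0 hh0) h1g
  have hw0 : 0 ≤ 1 - S / (h : ℝ) := by rw [sub_nonneg, div_le_one hh0]; exact hSh.le
  have hWG : 0 ≤ S / h * g := mul_nonneg (div_pos hS0 hh0).le hg0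
  -- the donor rate into `h` and `D`
  obtain ⟨UH, hUHd⟩ : ∃ q : ℝ, q = usage y t j k₁ h := ⟨_, rfl⟩
  obtain ⟨UP, hUPd⟩ : ∃ q : ℝ, q = usage y t j k₁ (k₁ + a) := ⟨_, rfl⟩
  rw [← hUHd] at hpool
  rw [← hUPd] at hcapP
  obtain ⟨D, hD⟩ : ∃ q : ℝ, q = UH * xH := ⟨_, rfl⟩
  have hD0 : 0 ≤ D := by
    rcases eq_or_lt_of_le hxH0 with hx0 | hxpos
    · rw [hD, ← hx0, mul_zero]
    · have hc := hHcomp hxpos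
      have hk1h : k₁ < h := by
        have : (k₁ : ℝ) < h := by linarith
        exact_mod_cast this
      have hUH0 : 0 < UH := by rw [hUHd]; exact usage_pos_of_compat y t j k₁ h hy0 hy1 hk₁low hk1h (Or.inr hc)
      rw [hD]; exact mul_nonneg hUH0.le hxH0
  -- the exchange inequality: D(u w₀ − W_G) ≤ w_h((1−z)λ − u z − u x_G)
  have hR0 : 0 ≤ (1 - z) * lam - y / (1 - y) * z - y / (1 - y) * xG := by nlinarith [mul_nonneg hu0.le hxG0]
  have hDR : D ≤ (1 - z) * lam - y / (1 - y) * z - y / (1 - y) * xG := by rw [hD]; linarith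
  have hEx : D * (y / (1 - y) * (1 - S / h) - S / h * g) ≤ S / h * (1 - g) * ((1 - z) * lam - y / (1 - y) * z - y / (1 - y) * xG) := by
    by_cases hX : y / (1 - y) * (1 - S / h) - S / h * g ≤ 0
    · exact le_trans (mul_nonpos_of_nonneg_of_nonpos hD0 hX) (mul_nonneg hwh.le hR0)
    · -- the exchange rate: u(1 − S/h) − (S/h)g ≤ (S/h)(1−g)  ⟸  y·h ≤ S
      have hrate : y / (1 - y) * (1 - S / h) - S / h * g ≤ S / h * (1 - g) := by
        have e1 : y / (1 - y) * (1 - S / h) - S / h * g - S / h * (1 - g) = (y * (h : ℝ) - S) / ((1 - y) * h) := by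
          field_simp
          ring
        have : (y * (h : ℝ) - S) / ((1 - y) * h) ≤ 0 := div_nonpos_of_nonpos_of_nonneg (by linarith) (mul_pos h1y hh0).le
        linarith
      calc D * (y / (1 - y) * (1 - S / h) - S / h * g) ≤ D * (S / h * (1 - g)) := mul_le_mul_of_nonneg_left hrate hD0
        _ = S / h * (1 - g) * D := by ring
        _ ≤ S / h * (1 - g) * ((1 - z) * lam - y / (1 - y) * z - y / (1 - y) * xG) := mul_le_mul_of_nonneg_left hDR hwh.le
  -- piece 1: the low k₁ into its twin (pair when compatible, else x_P = 0 and the twin is a point)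
  have PP : FlowAtT y t j (M + a)
      (fun p => S / h * (1 - g) * xP * (if p = k₁ then (1 : ℝ) else 0) + S / h * (1 - g) * m₁' * (if p = k₁ + a then (1 : ℝ) else 0)) := by
    by_cases hcP : t < (k₁ : ℝ) + ((k₁ + a : ℕ) : ℝ)
    · refine flowAtT_pair y t j (M + a) k₁ (k₁ + a) (S / h * (1 - g) * xP) (S / h * (1 - g) * m₁') hk₁j hk₁low (by omega)
        (Or.inr hPmid) (Or.inr hcP) (mul_nonneg hwh.le hxP0) ?_
      calc usage y t j k₁ (k₁ + a) * (S / h * (1 - g) * xP) = S / h * (1 - g) * (UP * xP) := by rw [hUPd]; ring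
        _ ≤ S / h * (1 - g) * m₁' := mul_le_mul_of_nonneg_left hcapP hwh.le
    · have hxP : xP = 0 := by
        by_contra hne
        exact hcP (hPcomp (lt_of_le_of_ne hxP0 (Ne.symm hne)))
      have Ppt := flowAtT_point y t j (M + a) (k₁ + a) (S / h * (1 - g) * m₁') (fun hc => by linarith [hc.2]) (mul_nonneg hwh.le hm₁'0)
      refine (congrArg (FlowAtT y t j (M + a)) (funext fun p => ?_)).mp Ppt
      rw [hxP]; ring
  -- piece 2: the overflow into W_h's mid h (exactly full), or nothing
  have PH : FlowAtT y t j (M + a)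
      (fun p => S / h * (1 - g) * xH * (if p = k₁ then (1 : ℝ) else 0) + D * (S / h * (1 - g)) * (if p = h then (1 : ℝ) else 0)) := by
    by_cases hcH : t < (k₁ : ℝ) + h
    · refine flowAtT_pair y t j (M + a) k₁ h (S / h * (1 - g) * xH) (D * (S / h * (1 - g))) hk₁j hk₁low (by omega)
        (Or.inr hhmid) (Or.inr hcH) (mul_nonneg hwh.le hxH0) (le_of_eq ?_)
      rw [hD, hUHd]; ring
    · have hxH : xH = 0 := by
        by_contra hne
        exact hcH (hHcomp (lt_of_le_of_ne hxH0 (Ne.symm hne)))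
      have hD0' : D = 0 := by rw [hD, hxH, mul_zero]
      have Ppt := flowAtT_point y t j (M + a) h 0 (fun hc => by linarith [hc.2]) le_rfl
      refine (congrArg (FlowAtT y t j (M + a)) (funext fun p => ?_)).mp Ppt
      rw [hxH, hD0']; ring
  -- piece 3: zeros + the giant part of k₁ + the three giant atoms, by criterion E
  set G : ℕ → ℝ := fun p => (D * (1 - S / h) + S / h * (1 - g) * z) * (if p = 0 then (1 : ℝ) else 0)
      + S / h * (1 - g) * xG * (if p = k₁ then (1 : ℝ) else 0)
      + D * (S / h * g) * (if p = h + a then (1 : ℝ) else 0)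
      + S / h * (1 - g) * ((1 - z) * lam * (1 - g)) * (if p = k₂ then (1 : ℝ) else 0)
      + S / h * (1 - g) * ((1 - z) * lam * g) * (if p = k₂ + a then (1 : ℝ) else 0) with hG
  have hind : ∀ (q : Prop) [Decidable q], (0 : ℝ) ≤ (if q then (1 : ℝ) else 0) := by
    intro q _; split <;> norm_num
  have hc0 : 0 ≤ D * (1 - S / h) + S / h * (1 - g) * z := add_nonneg (mul_nonneg hD0 hw0) (mul_nonneg hwh.le hz0)
  have hc1 : 0 ≤ S / h * (1 - g) * xG := mul_nonneg hwh.le hxG0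
  have hc2 : 0 ≤ D * (S / h * g) := mul_nonneg hD0 hWG
  have hc3 : 0 ≤ S / h * (1 - g) * ((1 - z) * lam * (1 - g)) := mul_nonneg hwh.le (mul_nonneg (mul_nonneg h1z.le hlam0) h1g.le)
  have hc4 : 0 ≤ S / h * (1 - g) * ((1 - z) * lam * g) := mul_nonneg hwh.le (mul_nonneg (mul_nonneg h1z.le hlam0) hg0)
  have hG0 : ∀ p, 0 ≤ G p := by
    intro p
    simp only [hG]
    exact add_nonneg (add_nonneg (add_nonneg (add_nonneg (mul_nonneg hc0 (hind _)) (mul_nonneg hc1 (hind _)))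
      (mul_nonneg hc2 (hind _))) (mul_nonneg hc3 (hind _))) (mul_nonneg hc4 (hind _))
  have hGlow : ∑ l ∈ Finset.range (j + 1), G l = D * (1 - S / h) + S / h * (1 - g) * z + S / h * (1 - g) * xG := by
    simp only [hG, Finset.sum_add_distrib]
    rw [sum_mul_indicator (fun _ => D * (1 - S / h) + S / h * (1 - g) * z) j 0 (by omega),
      sum_mul_indicator (fun _ => S / h * (1 - g) * xG) j k₁ hk₁j,
      sum_mul_indicator_eq_zero (fun _ => D * (S / h * g)) j (h + a) (by omega),
      sum_mul_indicator_eq_zero (fun _ => S / h * (1 - g) * ((1 - z) * lam * (1 - g))) j k₂ (by omega),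
      sum_mul_indicator_eq_zero (fun _ => S / h * (1 - g) * ((1 - z) * lam * g)) j (k₂ + a) (by omega)]
    ring
  have hGall : ∑ p ∈ Finset.range (M + a + 1), G p
      = D * (1 - S / h) + S / h * (1 - g) * z + S / h * (1 - g) * xG
        + (D * (S / h * g) + S / h * (1 - g) * ((1 - z) * lam * (1 - g)) + S / h * (1 - g) * ((1 - z) * lam * g)) := by
    simp only [hG, Finset.sum_add_distrib]
    rw [sum_mul_indicator (fun _ => D * (1 - S / h) + S / h * (1 - g) * z) (M + a) 0 (by omega),
      sum_mul_indicator (fun _ => S / h * (1 - g) * xG) (M + a) k₁ (by omega),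
      sum_mul_indicator (fun _ => D * (S / h * g)) (M + a) (h + a) (by omega),
      sum_mul_indicator (fun _ => S / h * (1 - g) * ((1 - z) * lam * (1 - g))) (M + a) k₂ (by omega),
      sum_mul_indicator (fun _ => S / h * (1 - g) * ((1 - z) * lam * g)) (M + a) (k₂ + a) (by omega)]
    ring
  have hGIco : ∑ p ∈ Finset.Ico (j + 1) (M + a + 1), G p
      = D * (S / h * g) + S / h * (1 - g) * ((1 - z) * lam * (1 - g)) + S / h * (1 - g) * ((1 - z) * lam * g) := by
    have := Finset.sum_range_add_sum_Ico G (show j + 1 ≤ M + a + 1 by omega)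
    rw [hGall, hGlow] at this
    linarith
  have PG : FlowAtT y t j (M + a) G := by
    refine flowAtT_of_giants y t j (M + a) G hy0 hy1 hG0 ?_
    have hle : ∑ l ∈ Finset.range (j + 1), (if 2 * (l : ℝ) < t then G l else 0)
        ≤ D * (1 - S / h) + S / h * (1 - g) * z + S / h * (1 - g) * xG := by
      rw [← hGlow]
      exact Finset.sum_le_sum fun l _ => by
        by_cases h2 : 2 * (l : ℝ) < t
        · rw [if_pos h2]
        · rw [if_neg h2]; exact hG0 l
    rw [hGIco]
    refine le_trans (mul_le_mul_of_nonneg_left hle hu0.le) ?_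
    have e : D * (S / h * g) + S / h * (1 - g) * ((1 - z) * lam * (1 - g)) + S / h * (1 - g) * ((1 - z) * lam * g)
        = D * (S / h * g) + S / h * (1 - g) * ((1 - z) * lam) := by ring
    rw [e]
    have e2 : y / (1 - y) * (D * (1 - S / h) + S / h * (1 - g) * z + S / h * (1 - g) * xG)
        - (D * (S / h * g) + S / h * (1 - g) * ((1 - z) * lam))
        = D * (y / (1 - y) * (1 - S / h) - S / h * g)
          - S / h * (1 - g) * ((1 - z) * lam - y / (1 - y) * z - y / (1 - y) * xG) := by ring
    linarith [hEx, e2]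
  -- assemble: D·W_h + w_h·P is flow-feasible
  have hsum := FlowAtT.add (FlowAtT.add PP PH) PG
  have key : ∀ p, D * weakMidLaw S g h a p
        + S / h * (1 - g) * (z * (if p = 0 then (1 : ℝ) else 0) + (1 - z) * slice (fun q => TP[k₁, k₂, lam, q]) a g p)
      = (S / h * (1 - g) * xP * (if p = k₁ then (1 : ℝ) else 0) + S / h * (1 - g) * m₁' * (if p = k₁ + a then (1 : ℝ) else 0))
        + (S / h * (1 - g) * xH * (if p = k₁ then (1 : ℝ) else 0) + D * (S / h * (1 - g)) * (if p = h then (1 : ℝ) else 0))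
        + G p := by
    intro p
    rw [movedTwoPoint_apply]
    simp only [weakMidLaw, hG, hm₁']
    linear_combination (-(S / h * (1 - g) * (if p = k₁ then (1 : ℝ) else 0))) * hsplit
  have hR' : FlowAtT y t j (M + a) (fun p => D * weakMidLaw S g h a p
      + S / h * (1 - g) * (z * (if p = 0 then (1 : ℝ) else 0) + (1 - z) * slice (fun q => TP[k₁, k₂, lam, q]) a g p)) := by
    refine (congrArg (FlowAtT y t j (M + a)) (funext fun p => ?_)).mp hsum
    exact (key p).symm
  -- normalise: θ = D/(w_h + D)
  have hden : 0 < S / h * (1 - g) + D := add_pos_of_pos_of_nonneg hwh hD0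
  obtain ⟨θ, hθ⟩ : ∃ q : ℝ, q = D / (S / h * (1 - g) + D) := ⟨_, rfl⟩
  have hθ0 : 0 ≤ θ := by rw [hθ]; exact div_nonneg hD0 hden.le
  have hθ1 : θ < 1 := by rw [hθ, div_lt_one hden]; linarith
  have h1θ : 1 - θ = S / h * (1 - g) / (S / h * (1 - g) + D) := by
    rw [hθ]; field_simp; ring
  have hR := hR'.smul (1 / (S / h * (1 - g) + D)) (by positivity)
  refine gatedSliceMixLaw_conclusion_of_flowAtT y z g S lam θ a j M h k₁ k₂ hy0 hy1 hhM hk hk₂M hθ0 hθ1 ?_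
  refine (congrArg (FlowAtT y t j (M + a)) (funext fun p => ?_)).mp hR
  rw [h1θ, hθ, div_eq_mul_one_div D, div_eq_mul_one_div (S / h * (1 - g)) (S / h * (1 - g) + D)]
  ring

/-! ### The sub-cell where the twin holds the whole low -/

/-- **CELL B-TWIN, THE TWIN HOLDS ALL OF `k₁`** (`t < k₁ + ℓ` and `usage(k₁,ℓ)·m₁ ≤ m₁'` — e.g. the pair `(k₁, ℓ)` light at `t`, or
its minimal gate at most `g`): the conclusion of `GatedSliceMixLaw'` with `θ = 0`; the zeros ride the giants by `mixLawB_QG`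
(`u·z ≤ (1−z)λ`, which needs the mean identity, `k₁ ≤ S` and `y·k₂ ≤ S`). [this work] -/
theorem gatedSliceMixLaw_BTwin_fit (y z g S lam : ℝ) (a j M h k₁ k₂ : ℕ)
    (hy0 : 0 < y) (hy1 : y < 1) (hz0 : 0 ≤ z) (hz1 : z < 1) (hg0 : 0 ≤ g) (hg1 : g < 1) (hyg : y ≤ (1 - z) * g)
    (hS0 : 0 < S) (hta : y * (M : ℝ) ≤ S) (hhj : h ≤ j) (hhM : h ≤ M) (hSh : S < (h : ℝ))
    (hk : k₁ ≤ k₂) (hk₂M : k₂ ≤ M) (hlam0 : 0 ≤ lam) (hlam1 : lam ≤ 1)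
    (hmean : (1 - z) * ((k₁ : ℝ) + ((k₂ : ℝ) - k₁) * lam) = S)
    (hk₁j : k₁ ≤ j) (hk₁low : 2 * (k₁ : ℝ) < S + (a : ℝ) * g * (1 - z))
    (hPj : k₁ + a ≤ j) (hPmid : S + (a : ℝ) * g * (1 - z) ≤ 2 * ((k₁ + a : ℕ) : ℝ))
    (hk₂G : j + 1 ≤ k₂) (hhaG : j + 1 ≤ h + a) (htS : S + (a : ℝ) * g * (1 - z) ≤ 2 * S)
    (hPcomp : S + (a : ℝ) * g * (1 - z) < (k₁ : ℝ) + ((k₁ + a : ℕ) : ℝ))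
    (hfit : usage y (S + (a : ℝ) * g * (1 - z)) j k₁ (k₁ + a) * ((1 - z) * (1 - lam) * (1 - g)) ≤ (1 - z) * (1 - lam) * g) :
    ∃ θ : ℝ, 0 ≤ θ ∧ θ < 1 ∧
      DECAtT y (S + (a : ℝ) * g * (1 - z)) j (M + a)
        (fun p => θ * weakMidLaw S g h a p
          + (1 - θ) * (z * (if p = 0 then (1 : ℝ) else 0) + (1 - z) * slice (fun q => TP[k₁, k₂, lam, q]) a g p)) := by
  have h1z : 0 < 1 - z := by linarith
  have hyz : y + z ≤ 1 := by nlinarith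
  have hk12 : (k₁ : ℝ) < k₂ := by
    have : k₁ < k₂ := by omega
    exact_mod_cast this
  have hyk₂ : y * (k₂ : ℝ) ≤ S := le_trans (mul_le_mul_of_nonneg_left (by exact_mod_cast hk₂M) hy0.le) hta
  have hk₁S : (k₁ : ℝ) ≤ S := by linarith
  have hQG : y / (1 - y) * z ≤ (1 - z) * lam := mixLawB_QG y z S lam k₁ k₂ hy0 hy1 hz0 hyz hk12 hk₁S hyk₂ hmean
  have hhmid : S + (a : ℝ) * g * (1 - z) ≤ 2 * (h : ℝ) := by linarith
  refine gatedSliceMixLaw_BTwin_exchange y z g S lam a j M h k₁ k₂ ((1 - z) * (1 - lam) * (1 - g)) 0 0 hy0 hy1 hz0 hz1 hg0 hg1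
    hS0 hta hhj hhM hSh hk hk₂M hlam0 hlam1 hk₁j hk₁low hPj hPmid hk₂G hhaG hhmid
    (mul_nonneg (mul_nonneg h1z.le (by linarith)) (by linarith)) le_rfl le_rfl (by ring) (fun _ => hPcomp)
    (fun h0 => absurd h0 (lt_irrefl 0)) hfit ?_
  simpa using hQG

/-! ### Cell B-TWIN from the pooled inequality (the one remaining real-algebra lemma) -/

set_option maxHeartbeats 800000 in
/-- **`MixLawCellBTwin` MODULO THE POOLED INEQUALITY.**  The binder of `LawDec.MixLawCellBTwin` (`…QuantGatedSliceMixLawRegimeBCells`)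
verbatim, plus ONE real hypothesis — the pooled inequality of the GREEDY split (`u = y/(1−y)`, `U_P = usage(k₁,ℓ)`, `U_H = usage(k₁,h)`):
`r·(m₁ − x_P*) + u·z ≤ (1−z)λ` with `x_P* = min(m₁, m₁'/U_P)` if the twin is compatible (`t < k₁ + ℓ`) else `0`, and `r = min(u, U_H)` if
`t < k₁ + h` else `u` — implies the conclusion (`g < 1` from `W_h ∉ D` by `decAtT_weakMidLaw_of_giant`; then `gatedSliceMixLaw_BTwin_fit`
or `gatedSliceMixLaw_BTwin_exchange` with the greedy split).  Seat census: the hypothesis holds in 100 000 / 100 000 cell instances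
(`k₁ = 0` included, W DEC or not); it is the open real-algebra lemma of the cell. [this work] -/
theorem mixLawCellBTwin_of_pooled (y z g S lam : ℝ) (a j M h k₁ k₂ : ℕ)
    (hy0 : 0 < y) (hy1 : y < 1) (hz0 : 0 ≤ z) (hz1 : z < 1) (hg1 : g ≤ 1) (hyg : y ≤ (1 - z) * g) (ha1 : 1 ≤ a)
    (_hjM : j < M + a) (hS0 : 0 < S) (hta : y * (M : ℝ) ≤ S) (hhj : h ≤ j) (hhM : h ≤ M) (hSh : S < (h : ℝ))
    (hW : ¬ DECAtT y (S + (a : ℝ) * g * (1 - z)) j (M + a) (weakMidLaw S g h a))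
    (hk : k₁ ≤ k₂) (hk₂M : k₂ ≤ M) (hlam0 : 0 ≤ lam) (hlam1 : lam ≤ 1)
    (_hmean : (1 - z) * ((k₁ : ℝ) + ((k₂ : ℝ) - k₁) * lam) = S)
    (hk₁j : k₁ ≤ j) (hk₁low : 2 * (k₁ : ℝ) < S + (a : ℝ) * g * (1 - z)) (hPj : k₁ + a ≤ j) (_hk₂aG : j + 1 ≤ k₂ + a)
    (htS : S + (a : ℝ) * g * (1 - z) ≤ 2 * S) (hhaG : j + 1 ≤ h + a)
    (hPmid : S + (a : ℝ) * g * (1 - z) ≤ 2 * ((k₁ + a : ℕ) : ℝ)) (hk₂G : j + 1 ≤ k₂)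
    (hPI : (if S + (a : ℝ) * g * (1 - z) < (k₁ : ℝ) + (h : ℝ) then min (y / (1 - y)) (usage y (S + (a : ℝ) * g * (1 - z)) j k₁ h)
              else y / (1 - y))
            * ((1 - z) * (1 - lam) * (1 - g)
              - (if S + (a : ℝ) * g * (1 - z) < (k₁ : ℝ) + ((k₁ + a : ℕ) : ℝ)
                  then min ((1 - z) * (1 - lam) * (1 - g))
                    ((1 - z) * (1 - lam) * g / usage y (S + (a : ℝ) * g * (1 - z)) j k₁ (k₁ + a))
                  else 0))
          + y / (1 - y) * z ≤ (1 - z) * lam) :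
    ∃ θ : ℝ, 0 ≤ θ ∧ θ < 1 ∧
      DECAtT y (S + (a : ℝ) * g * (1 - z)) j (M + a)
        (fun p => θ * weakMidLaw S g h a p
          + (1 - θ) * (z * (if p = 0 then (1 : ℝ) else 0) + (1 - z) * slice (fun q => TP[k₁, k₂, lam, q]) a g p)) := by
  classical
  set t : ℝ := S + (a : ℝ) * g * (1 - z) with ht
  -- `g < 1` from `W_h ∉ D`
  have h1y : 0 < 1 - y := by linarith
  have h1z : 0 < 1 - z := by linarith
  have hg0 : 0 < g := by nlinarith
  have hh0 : (0 : ℝ) < h := lt_trans hS0 hSh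
  have hyh : y * (h : ℝ) ≤ S := le_trans (mul_le_mul_of_nonneg_left (by exact_mod_cast hhM) hy0.le) hta
  have hhmid : t ≤ 2 * (h : ℝ) := by rw [ht]; linarith
  have hXw : ¬ (y / (1 - y) * (1 - S / h) ≤ S / h * g) := fun hcov =>
    hW (decAtT_weakMidLaw_of_giant y z g S a j M h hy0 hy1 hg0.le hg1 hS0.le hSh hhj hhM hhaG hhmid hcov)
  have hg1' : g < 1 := by
    by_contra hge
    have hgeq : g = 1 := le_antisymm hg1 (not_lt.1 hge)
    apply hXw
    rw [hgeq, mul_one, div_mul_eq_mul_div, div_le_iff₀ h1y]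
    have hys : y ≤ S / h := by rw [le_div_iff₀ hh0]; exact hyh
    nlinarith
  have h1g : 0 < 1 - g := by linarith
  have h1lam : 0 ≤ 1 - lam := by linarith
  set m₁ : ℝ := (1 - z) * (1 - lam) * (1 - g) with hm₁
  set m₁' : ℝ := (1 - z) * (1 - lam) * g with hm₁'
  have hm₁0 : 0 ≤ m₁ := mul_nonneg (mul_nonneg h1z.le h1lam) h1g.le
  have hm₁'0 : 0 ≤ m₁' := mul_nonneg (mul_nonneg h1z.le h1lam) hg0.le
  have hu0 : 0 < y / (1 - y) := div_pos hy0 h1y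
  -- the twin amount of the greedy split
  obtain ⟨xP, hxP0, hxP1, hcapP, hPcomp, hPI'⟩ : ∃ xP : ℝ, 0 ≤ xP ∧ xP ≤ m₁ ∧
      usage y t j k₁ (k₁ + a) * xP ≤ m₁' ∧ (0 < xP → t < (k₁ : ℝ) + ((k₁ + a : ℕ) : ℝ)) ∧
      (if t < (k₁ : ℝ) + (h : ℝ) then min (y / (1 - y)) (usage y t j k₁ h) else y / (1 - y)) * (m₁ - xP)
        + y / (1 - y) * z ≤ (1 - z) * lam := by
    by_cases hcP : t < (k₁ : ℝ) + ((k₁ + a : ℕ) : ℝ)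
    · rw [if_pos hcP] at hPI
      have hUP0 : 0 < usage y t j k₁ (k₁ + a) :=
        usage_pos_of_compat y t j k₁ (k₁ + a) hy0 hy1 hk₁low (by omega) (Or.inr hcP)
      by_cases hfit : usage y t j k₁ (k₁ + a) * m₁ ≤ m₁'
      · refine ⟨m₁, hm₁0, le_rfl, hfit, fun _ => hcP, ?_⟩
        have hmin : min m₁ (m₁' / usage y t j k₁ (k₁ + a)) = m₁ :=
          min_eq_left (by rw [le_div_iff₀ hUP0]; linarith)
        rw [hmin] at hPI
        exact hPI
      · have hlt : m₁' / usage y t j k₁ (k₁ + a) < m₁ := by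
          rw [div_lt_iff₀ hUP0]; linarith
        refine ⟨m₁' / usage y t j k₁ (k₁ + a), div_nonneg hm₁'0 hUP0.le, hlt.le, ?_, fun _ => hcP, ?_⟩
        · rw [mul_div_cancel₀ _ hUP0.ne']
        · have hmin : min m₁ (m₁' / usage y t j k₁ (k₁ + a)) = m₁' / usage y t j k₁ (k₁ + a) := min_eq_right hlt.le
          rw [hmin] at hPI
          exact hPI
    · rw [if_neg hcP] at hPI
      refine ⟨0, le_rfl, hm₁0, by rw [mul_zero]; exact hm₁'0, fun h0 => absurd h0 (lt_irrefl 0), ?_⟩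
      exact hPI
  -- the overflow rides `W_h`'s mid when that is compatible and cheaper, else the giants
  by_cases hH : t < (k₁ : ℝ) + (h : ℝ) ∧ usage y t j k₁ h ≤ y / (1 - y)
  · rw [if_pos hH.1, min_eq_right hH.2] at hPI'
    exact gatedSliceMixLaw_BTwin_exchange y z g S lam a j M h k₁ k₂ xP (m₁ - xP) 0 hy0 hy1 hz0 hz1 hg0.le hg1' hS0 hta hhj hhM hSh
      hk hk₂M hlam0 hlam1 hk₁j hk₁low hPj hPmid hk₂G hhaG hhmid hxP0 (by linarith) le_rfl (by ring) hPcomp (fun _ => hH.1) hcapP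
      (by linarith)
  · have hr : (if t < (k₁ : ℝ) + (h : ℝ) then min (y / (1 - y)) (usage y t j k₁ h) else y / (1 - y)) = y / (1 - y) := by
      by_cases hcH : t < (k₁ : ℝ) + (h : ℝ)
      · rw [if_pos hcH]
        exact min_eq_left (le_of_lt (not_le.1 fun hle => hH ⟨hcH, hle⟩))
      · rw [if_neg hcH]
    rw [hr] at hPI'
    exact gatedSliceMixLaw_BTwin_exchange y z g S lam a j M h k₁ k₂ xP 0 (m₁ - xP) hy0 hy1 hz0 hz1 hg0.le hg1' hS0 hta hhj hhM hSh
      hk hk₂M hlam0 hlam1 hk₁j hk₁low hPj hPmid hk₂G hhaG hhmid hxP0 le_rfl (by linarith) (by ring) hPcomp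
      (fun h0 => absurd h0 (lt_irrefl 0)) hcapP (by linarith)

end LawDec

end Quant

end Summit.CriticalPhenomena.PercolationContinuityZ3.Theorems
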